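import Summits.BirchSwinnertonDyer.Rank1Residual.AdditivePotMult.RankOneHeegnerOdd
import Literature.NumberTheory.EllipticCurves.MatarNekovar2019.ShaIndexBoundIrreducible
import HarnessLib

/-!
# Rank ONE at an additive potentially multiplicative prime, EVERY ODD `p`, NO IMAGE HYPOTHESIS: Kolyvagin's
# Tamagawa-defect inequality relative to the rank-zero Heegner twist's lower half under IRREDUCIBILITY of
# `E[p]` only, and on ALL of X4(M) the rank-one `BSD(E,p)` from LOWER halves alone
# (cell `b2b-bsdres`, seat additive-p1, gen 13)

HONEST FRAMING (cell `b2b-bsdres`, run/shared/lean/b2b/bsd-rank1-residual/, verbatim in every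
file): the goal of the cell is to DELETE the COMBINATION-SHAPED residual classes of the
Birch–Swinnerton-Dyer formula for ALL analytic-rank `≤ 1` elliptic curves over `ℚ` — "full BSD
formula for every rank `≤ 1` curve in class `C`" assembled STRICTLY from published theorems — so
that the rank-`≤ 1` remainder becomes exactly the CONSTRUCTION-SHAPED classes, which are TYPED
(missing-input `Prop`s), NOT attempted. This is not "finishing BSD". The additive sub-cell (seats
additive-p1…p4) is a RESEARCH ROUTE on the construction-shaped classes X3/X4; sub-cell additive-p1
= the potentially MULTIPLICATIVE additive prime (X3♯(M) / X4(M)); no claim beyond the stated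
classes; the labels of X3/X4 are UNCHANGED by this file; nothing is booked.

Theorems only (no definition, no new named fact).

## What this file records

Gen 10's `RankOneHeegnerOdd.lean` (p238418) proved, at every odd bad prime, Kolyvagin's Tamagawa-defect
inequality in rank one relative to the LOWER half of a rank-zero Heegner twist, and on X4(M) the
class-level reading "`BSD(E,p)` ⇐ the LOWER halves of the same-`j` X4(M) pairs" — under the binder
`Surj W p`, because the `Ш`-bound over `K` was Kolyvagin's theorem in McCallum's form (`p` odd, `ρ̄`
ONTO). The data-level theorem there (`padicValNat_shaOrder_le_add_of_heegnerData_of_lowerTwist_of_odd`)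
already takes the bound as an abstract hypothesis `hU`; this file feeds it the tree's PUBLISHED named
fact `MatarNekovar2019.thm03_padicValNat_card_sha_le_of_irreducible` (Matar–Nekovář, JTNB 31 (2019),
Thm. 0.3 + §0.4 + §0.11 + Cor. 5.21 (e′) + Prop. 5.26 (2) = Kolyvagin 1990 Cor. 13 under
IRREDUCIBILITY of `E[p]`; `d_K ≠ −3, −4`; cell row A91, flags `MN19-0.11-composite`,
`Kolyvagin1990-Cor13-primary-unread`) — the Hoffstein–Luo field has `d_K < −4` — and drops `Surj`.
Since `Irr W p` is part of `ClassX4 W p`: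

**`ClassX4M.missingUpperBoundAt_rankOne_of_lowerTwists_of_odd`** — on ALL of X4(M) (no image
hypothesis), rank one, every odd `p`, Manin datum, `p ∤ ∏c_ℓ(E)`: the UPPER half of `BSD(E,p)` ⇐ the
LOWER halves of the rank-zero X4(M) pairs with the same `j`; and
**`bsdp_of_classX4M_rankOne_of_lower_of_lowerTwists_of_odd`** — `BSD(E,p)` ⇐ the pair's own lower
half + those. So the RESIDUAL-MAP cell E-iii ∧ ¬Surj (rank-one X4(M) pairs with irreducible
non-surjective `ρ̄_{E,p}`: `p = 3` images `3Ns`/`3Nn`, `p ∈ {5,7}`; 56 S-b pairs; window 2178h1,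
11520p1), which had "no class-level kernel statement" (§E table), now reads exactly like E-iii ∧ Surj:
`BSD(E,p)` ⇐ `Typed.MissingLowerBoundAt E p` ∧ X_E1 at the same-`j` rank-zero twists (+ Manin datum,
`p ∤ ∏c_ℓ(E)`). In BOTH ranks the image still matters for rank ZERO (Kato's divisibility on the
`ω^{(p−1)/2}`-component needs `ρ_{E♭,p^∞}` onto; cell E-ii unchanged), so the both-ranks capstone
`bsdp_of_classX4M_of_surj_of_lowerHalves_of_odd` keeps `Surj`; at `p ≥ 11` it is discharged
(`RankOneHeegnerLargePrime.lean`). X3♯(M) in rank one (`E[p]` REDUCIBLE) is NOT reached: Matar–Nekovář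
§0.10 (p. 457) "the current state of the art requires an irreducibility assumption for `ρ̄_{E,p}` … in
order to obtain, by Kolyvagin's method, an upper bound on the size of `Ш(E/K)[p^∞]` without any error
terms" — the printed boundary of the method. Nothing booked; X4(M) stays CONSTRUCTION-SHAPED.

References: [MatarNekovar2019] Thm. 0.3, §0.4, §0.10–0.11, Cor. 5.21, Prop. 5.26;
[KolyvaginEulerSystems1990] Cor. 13; [JetchevSkinnerWan2017] §7.4.1–7.4.2; [HoffsteinLuo1997] Theorem;
[CastellaEtAl2021] proof of Thm. 5.3.1 (a)–(d); [SilvermanATAEC1994] IV.9.4 Table 4.1;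
[Miller2011LMS] Def. 1.1.
-/

noncomputable section

open scoped Classical NumberField

open WeierstrassCurve NumberField Literature.NumberTheory.EllipticCurves
  Literature.NumberTheory.EllipticCurves.ModularForms
  Literature.NumberTheory.EllipticCurves.Rank1Residual
  Literature.NumberTheory.EllipticCurves.Rank1Residual.Typed
  Literature.NumberTheory.Automorphic
  IsDedekindDomain

namespace Summit.BirchSwinnertonDyer.Rank1Residual.AdditivePotMult

/-! ### §1 Class level, any bad odd `p`, `E[p]` irreducible: the field by Hoffstein–Luo, the bound by Matar–Nekovář -/

/-- **Kolyvagin's Tamagawa defect at an ADDITIVE (or any bad) ODD prime, rank one, `E[p]` IRREDUCIBLE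
(no surjectivity), relative to the rank-zero Heegner twists' lower halves.** `W/ℚ` globally minimal,
`ord_{s=1} L(E,s) = 1`, `p` an ODD prime of BAD reduction with `E[p]` irreducible, `D` a datum at level
`N_E` with `p ∤ c(D)`; ASSUME `MissingLowerBoundAt Wd p` for every globally minimal model `Wd` of a
rank-zero twist `E^{(d_K)}` by an imaginary quadratic Heegner field `K`. Then `#Ш(E)_an = q ∈ ℚ`,
`ord_p #Ш(E) ≤ ord_p q + 2·ord_p ∏_ℓ c_ℓ(E)`. PUBLISHED binders: Gross–Zagier `hGZ`, Kolyvagin `hKo`,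
Matar–Nekovář's irreducible-image form of the `Ш`-bound `hMN` (`d_K ≠ −3, −4`: the Hoffstein–Luo field
has `d_K < −4`), GZK `hGZK`, modularity `hmod`/`hnf`, Hoffstein–Luo `hHL` (x1a's
`exists_admissibleField_of_rootNumber_eq_neg_one`: `d_K ≡ 1 (mod 8)`, `d_K < −4`, every prime of `N_E`
split, `L(E^{(d_K)},1) ≠ 0`). Gen 10's `…_of_lowerTwists_of_odd` with `Surj` replaced by `Irr`; the data
level is gen 10's `padicValNat_shaOrder_le_add_of_heegnerData_of_lowerTwist_of_odd` verbatim.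
Nothing booked. [cite: MatarNekovar2019, Thm. 0.3 (p. 456), §0.11 (p. 457), Cor. 5.21 (e′), Prop. 5.26 (2)]
[cite: HoffsteinLuo1997, Theorem (§1, pp. 435–436)] [cite: CastellaEtAl2021, proof of Thm. 5.3.1, conditions (a)–(d)]
[cite: Miller2011LMS, Def. 1.1] -/
theorem padicValNat_shaOrder_le_add_of_bad_rankOne_of_lowerTwists_of_odd_of_irr
    (hGZ : ∀ (N : ℕ) [NeZero N] (W : WeierstrassCurve ℚ) (K : Type) [Field K] [NumberField K],
      gross_zagier N W K)
    (hKo : ∀ (N : ℕ) [NeZero N] (W : WeierstrassCurve ℚ) (K : Type) [Field K] [NumberField K],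
      kolyvagin N W K)
    (hMN : ∀ (N : ℕ) [NeZero N] (W : WeierstrassCurve ℚ) (K : Type) [Field K] [NumberField K],
      MatarNekovar2019.thm03_padicValNat_card_sha_le_of_irreducible N W K)
    (hGZK : rank_eq_analyticRank_of_analyticRank_le_one) (hmod : hasEntireLFunction_rat)
    (hnf : exists_isNewformOf) (hHL : HoffsteinLuo1997_exists_twist_L_one_ne_zero)
    (W : WeierstrassCurve ℚ) [W.IsElliptic] [W.IsGloballyMinimal] (p : ℕ) [Fact p.Prime]
    [NeZero (W.conductorNorm ℤ)]
    (hbad : ¬ Good W p) (hirr : Irr W p) (hp2 : p ≠ 2) (hr : W.analyticRank = 1)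
    (D : ModularParametrizationData W (W.conductorNorm ℤ)) (hc : ¬ (p : ℤ) ∣ D.c)
    (hlow : ∀ (K : Type) [Field K] [NumberField K] (Wd : WeierstrassCurve ℚ) [Wd.IsElliptic]
      [Wd.IsGloballyMinimal], IsImaginaryQuadratic K →
      SatisfiesHeegnerHypothesis (W.conductorNorm ℤ) K →
      (∃ C : VariableChange ℚ, C • W.quadraticTwist (NumberField.discr K : ℚ) = Wd) →
      Wd.analyticRank = 0 → MissingLowerBoundAt Wd p) :
    ∃ q : ℚ, shaAn W = (q : ℂ) ∧
      (padicValNat p W.shaOrder : ℤ) ≤ padicValRat p q + 2 * padicValNat p W.tamagawaProduct := by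
  have hp : p.Prime := Fact.out
  have hpN : p ∣ W.conductorNorm ℤ := (W.dvd_conductorNorm_iff_not_hasGoodReductionAtPrime p).mpr hbad
  -- the sign of the functional equation is `−1` (modularity, `r_an = 1`)
  have hw : W.rootNumber = -1 := by
    rw [WeierstrassCurve.rootNumber_eq_neg_one_pow_analyticRank_of_exists_isNewformOf hnf W, hr]
    norm_num
  -- the admissible field (Hoffstein–Luo): `d_K` odd, `d_K < -4`, every `ℓ ∣ N` split, `L(E^{d_K},1) ≠ 0`
  obtain ⟨K, _, _, hK, hodd, hd4, hHN, -, hLt⟩ :=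
    exists_admissibleField_of_rootNumber_eq_neg_one hnf hHL W hw p
  have hD3 : NumberField.discr K ≠ -3 := by omega
  have hD4 : NumberField.discr K ≠ -4 := by omega
  -- `w_K = 2`, prime to the odd `p`
  have hμ : ¬ p ∣ Units.torsionOrder K := by
    rw [Literature.NumberTheory.DiophantineGeometry.torsionOrder_eq_two_of_discr_lt hK.1 hd4]
    intro h2
    exact hp2 ((Nat.prime_dvd_prime_iff_eq hp Nat.prime_two).mp h2)
  -- the Heegner datum and the `K`-rational Heegner point of the given parametrisation datum `D`
  obtain ⟨β, hβ⟩ := exists_dvd_sq_sub_discr_holds (W.conductorNorm ℤ) K hK hHN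
  obtain ⟨H, -⟩ := nonempty_heegnerDatum_holds (W.conductorNorm ℤ) K hK hβ
  obtain ⟨ι⟩ : Nonempty (K →+* ℂ) := inferInstance
  obtain ⟨P, hP⟩ := heegnerPointComplex_mem_range_map_holds (W.conductorNorm ℤ) W K hK hHN D H ι
  -- a globally minimal model of the twist
  have hD0 : (NumberField.discr K : ℚ) ≠ 0 := by exact_mod_cast NumberField.discr_ne_zero K
  haveI hEt : (W.quadraticTwist (NumberField.discr K : ℚ)).IsElliptic :=
    W.isElliptic_quadraticTwist hD0
  obtain ⟨Cd, hCd⟩ := hasGlobalMinimalModel_rat_holds (W.quadraticTwist (NumberField.discr K : ℚ))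
  haveI : (Cd • W.quadraticTwist (NumberField.discr K : ℚ)).IsGloballyMinimal := hCd
  have hWd : Cd • W.quadraticTwist (NumberField.discr K : ℚ) =
      Cd • W.quadraticTwist (NumberField.discr K : ℚ) := rfl
  -- the twist has analytic rank `0`
  have hrd : (Cd • W.quadraticTwist (NumberField.discr K : ℚ)).analyticRank = 0 := by
    rw [analyticRank_smul]
    exact analyticRank_eq_zero_of_entireLFunction_one_ne_zero _ hLt
  have hlowd := hlow K (Cd • W.quadraticTwist (NumberField.discr K : ℚ)) hK hHN ⟨Cd, rfl⟩ hrd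
  exact padicValNat_shaOrder_le_add_of_heegnerData_of_lowerTwist_of_odd W p K D H ι P (hGZ _ W K)
    (hKo _ W K) hGZK hmod hr hp2 hpN hirr hK hodd hHN hP hc hμ hLt
    (Cd • W.quadraticTwist (NumberField.discr K : ℚ)) Cd hWd hlowd
    (fun _ hnt ↦ hMN _ W K hK hHN hD3 hD4 ⟨D, H, ι, hP⟩ hnt hp hp2 hirr)

/-- **The upper half on `p ∤ ∏ c_ℓ`, any bad ODD `p`, `E[p]` IRREDUCIBLE** (same hypotheses):
`Typed.MissingUpperBoundAt W p` (`ord_p #Ш(E) ≤ ord_p #Ш(E)_an`).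
[cite: MatarNekovar2019, Thm. 0.3 (p. 456), §0.11 (p. 457)] [cite: Miller2011LMS, Def. 1.1] -/
theorem missingUpperBoundAt_of_bad_rankOne_of_lowerTwists_of_odd_of_irr
    (hGZ : ∀ (N : ℕ) [NeZero N] (W : WeierstrassCurve ℚ) (K : Type) [Field K] [NumberField K],
      gross_zagier N W K)
    (hKo : ∀ (N : ℕ) [NeZero N] (W : WeierstrassCurve ℚ) (K : Type) [Field K] [NumberField K],
      kolyvagin N W K)
    (hMN : ∀ (N : ℕ) [NeZero N] (W : WeierstrassCurve ℚ) (K : Type) [Field K] [NumberField K],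
      MatarNekovar2019.thm03_padicValNat_card_sha_le_of_irreducible N W K)
    (hGZK : rank_eq_analyticRank_of_analyticRank_le_one) (hmod : hasEntireLFunction_rat)
    (hnf : exists_isNewformOf) (hHL : HoffsteinLuo1997_exists_twist_L_one_ne_zero)
    (W : WeierstrassCurve ℚ) [W.IsElliptic] [W.IsGloballyMinimal] (p : ℕ) [Fact p.Prime]
    [NeZero (W.conductorNorm ℤ)]
    (hbad : ¬ Good W p) (hirr : Irr W p) (hp2 : p ≠ 2) (hr : W.analyticRank = 1)
    (D : ModularParametrizationData W (W.conductorNorm ℤ)) (hc : ¬ (p : ℤ) ∣ D.c)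
    (htam : ¬ p ∣ W.tamagawaProduct)
    (hlow : ∀ (K : Type) [Field K] [NumberField K] (Wd : WeierstrassCurve ℚ) [Wd.IsElliptic]
      [Wd.IsGloballyMinimal], IsImaginaryQuadratic K →
      SatisfiesHeegnerHypothesis (W.conductorNorm ℤ) K →
      (∃ C : VariableChange ℚ, C • W.quadraticTwist (NumberField.discr K : ℚ) = Wd) →
      Wd.analyticRank = 0 → MissingLowerBoundAt Wd p) :
    MissingUpperBoundAt W p := by
  obtain ⟨q, hq, hle⟩ := padicValNat_shaOrder_le_add_of_bad_rankOne_of_lowerTwists_of_odd_of_irr hGZ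
    hKo hMN hGZK hmod hnf hHL W p hbad hirr hp2 hr D hc hlow
  refine ⟨q, hq, ?_⟩
  rw [padicValNat.eq_zero_of_not_dvd htam, Nat.cast_zero, mul_zero, add_zero] at hle
  exact hle

/-- **`BSD(E,p)` in rank one at a bad ODD prime, `E[p]` IRREDUCIBLE, from LOWER halves only** (same
hypotheses, plus the lower half `MissingLowerBoundAt W p` for `E` itself).
[cite: MatarNekovar2019, Thm. 0.3 (p. 456), §0.11 (p. 457)] [cite: Miller2011LMS, Def. 1.1] -/
theorem bsdp_of_bad_rankOne_of_lower_of_lowerTwists_of_odd_of_irr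
    (hGZ : ∀ (N : ℕ) [NeZero N] (W : WeierstrassCurve ℚ) (K : Type) [Field K] [NumberField K],
      gross_zagier N W K)
    (hKo : ∀ (N : ℕ) [NeZero N] (W : WeierstrassCurve ℚ) (K : Type) [Field K] [NumberField K],
      kolyvagin N W K)
    (hMN : ∀ (N : ℕ) [NeZero N] (W : WeierstrassCurve ℚ) (K : Type) [Field K] [NumberField K],
      MatarNekovar2019.thm03_padicValNat_card_sha_le_of_irreducible N W K)
    (hGZK : rank_eq_analyticRank_of_analyticRank_le_one) (hmod : hasEntireLFunction_rat)
    (hnf : exists_isNewformOf) (hHL : HoffsteinLuo1997_exists_twist_L_one_ne_zero)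
    (W : WeierstrassCurve ℚ) [W.IsElliptic] [W.IsGloballyMinimal] (p : ℕ) [Fact p.Prime]
    [NeZero (W.conductorNorm ℤ)]
    (hbad : ¬ Good W p) (hirr : Irr W p) (hp2 : p ≠ 2) (hr : W.analyticRank = 1)
    (D : ModularParametrizationData W (W.conductorNorm ℤ)) (hc : ¬ (p : ℤ) ∣ D.c)
    (htam : ¬ p ∣ W.tamagawaProduct) (hlowW : MissingLowerBoundAt W p)
    (hlow : ∀ (K : Type) [Field K] [NumberField K] (Wd : WeierstrassCurve ℚ) [Wd.IsElliptic]
      [Wd.IsGloballyMinimal], IsImaginaryQuadratic K →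
      SatisfiesHeegnerHypothesis (W.conductorNorm ℤ) K →
      (∃ C : VariableChange ℚ, C • W.quadraticTwist (NumberField.discr K : ℚ) = Wd) →
      Wd.analyticRank = 0 → MissingLowerBoundAt Wd p) :
    BSDp W p :=
  bsdp_of_missingPPartAt W p hGZK (by rw [hr])
    (missingPPartAt_of_lower_of_upper W p hlowW
      (missingUpperBoundAt_of_bad_rankOne_of_lowerTwists_of_odd_of_irr hGZ hKo hMN hGZK hmod hnf hHL W
        p hbad hirr hp2 hr D hc htam hlow))

/-! ### §2 X4(M), every odd `p`, NO image hypothesis: rank one from the rank-zero twists' lower halves -/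

variable {W : WeierstrassCurve ℚ} [W.IsElliptic] [W.IsGloballyMinimal] {p : ℕ} [Fact p.Prime]

/-- **X4(M) — NO image hypothesis —, RANK ONE, ANY odd `p` (so `p = 3`), Manin datum, `p ∤ ∏c_ℓ(E)`:
the UPPER half of `BSD(E,p)` from the LOWER halves of the RANK-ZERO X4(M) pairs with the same
`j`-invariant** (the Heegner twists are such pairs, `ClassX4M.twist_of_heegner`). Supersedes gen 10's
`ClassX4M.missingUpperBoundAt_rankOne_of_surj_of_lowerTwists_of_odd` / `…_of_not_dvd_padicValRat_j_…`
as to the image: the rank-one X4(M) pairs with irreducible NON-surjective `ρ̄_{E,p}` (RESIDUAL-MAP §E,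
E-iii ∧ ¬Surj: 56 S-b pairs; `p = 3` images `3Ns`/`3Nn`, window 2178h1, 11520p1) enter the class-level
statement. X4(M) stays CONSTRUCTION-SHAPED; nothing booked.
[cite: MatarNekovar2019, Thm. 0.3 (p. 456), §0.11 (p. 457)] [cite: HoffsteinLuo1997, Theorem (§1, pp. 435–436)]
[cite: Miller2011LMS, Def. 1.1] -/
theorem ClassX4M.missingUpperBoundAt_rankOne_of_lowerTwists_of_odd
    (hGZ : ∀ (N : ℕ) [NeZero N] (W : WeierstrassCurve ℚ) (K : Type) [Field K] [NumberField K],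
      gross_zagier N W K)
    (hKo : ∀ (N : ℕ) [NeZero N] (W : WeierstrassCurve ℚ) (K : Type) [Field K] [NumberField K],
      kolyvagin N W K)
    (hMN : ∀ (N : ℕ) [NeZero N] (W : WeierstrassCurve ℚ) (K : Type) [Field K] [NumberField K],
      MatarNekovar2019.thm03_padicValNat_card_sha_le_of_irreducible N W K)
    (hGZK : rank_eq_analyticRank_of_analyticRank_le_one) (hmod : hasEntireLFunction_rat)
    (hnf : exists_isNewformOf) (hHL : HoffsteinLuo1997_exists_twist_L_one_ne_zero)
    [NeZero (W.conductorNorm ℤ)]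
    (hX : ClassX4M W p) (hr : W.analyticRank = 1)
    (D : ModularParametrizationData W (W.conductorNorm ℤ)) (hc : ¬ (p : ℤ) ∣ D.c)
    (htam : ¬ p ∣ W.tamagawaProduct)
    (hlow : ∀ (V : WeierstrassCurve ℚ) [V.IsElliptic] [V.IsGloballyMinimal], ClassX4M V p →
      V.j = W.j → V.analyticRank = 0 → MissingLowerBoundAt V p) :
    MissingUpperBoundAt W p :=
  missingUpperBoundAt_of_bad_rankOne_of_lowerTwists_of_odd_of_irr hGZ hKo hMN hGZK hmod hnf hHL W p
    hX.1.2.1.1 hX.irr hX.p_ne_two hr D hc htam fun K _ _ Wd _ _ hK hHN hWd hrd ↦ by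
      obtain ⟨hXd, hj⟩ := hX.twist_of_heegner K hK hHN Wd hWd
      exact hlow Wd hXd hj hrd

/-- **X4(M) — NO image hypothesis —, RANK ONE, ANY odd `p`: `BSD(E,p)` from LOWER halves alone, every
other input PUBLISHED.** `(E,p) ∈ X4(M)` (`W` globally minimal), `ord_{s=1} L(E,s) = 1`, datum `D` at
level `N_E` with `p ∤ c(D)`, `p ∤ ∏_ℓ c_ℓ(E)`: if `E` itself and every RANK-ZERO X4(M) pair `(V,p)` with
`j(V) = j(E)` satisfy `MissingLowerBoundAt · p`, then `BSDp W p`. In kernel currency: on X4(M), r = 1,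
**`BSD(E,p)` ⇐ [`Typed.MissingLowerBoundAt E p`] ∧ [X_E1 at the same-`j` rank-zero twists]** (+ Manin
datum, `p ∤ ∏c_ℓ(E)`), with NO image input — the rank-one half of gen 10's both-ranks capstone
`bsdp_of_classX4M_of_surj_of_lowerHalves_of_odd` freed of `Surj` (rank zero keeps it: Kato's
divisibility on the `ω^{(p−1)/2}`-component). X4(M) stays CONSTRUCTION-SHAPED; nothing booked.
[cite: MatarNekovar2019, Thm. 0.3 (p. 456), §0.11 (p. 457)] [cite: HoffsteinLuo1997, Theorem (§1, pp. 435–436)]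
[cite: Miller2011LMS, Def. 1.1] -/
theorem bsdp_of_classX4M_rankOne_of_lower_of_lowerTwists_of_odd
    (hGZ : ∀ (N : ℕ) [NeZero N] (W : WeierstrassCurve ℚ) (K : Type) [Field K] [NumberField K],
      gross_zagier N W K)
    (hKo : ∀ (N : ℕ) [NeZero N] (W : WeierstrassCurve ℚ) (K : Type) [Field K] [NumberField K],
      kolyvagin N W K)
    (hMN : ∀ (N : ℕ) [NeZero N] (W : WeierstrassCurve ℚ) (K : Type) [Field K] [NumberField K],
      MatarNekovar2019.thm03_padicValNat_card_sha_le_of_irreducible N W K)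
    (hGZK : rank_eq_analyticRank_of_analyticRank_le_one) (hmod : hasEntireLFunction_rat)
    (hnf : exists_isNewformOf) (hHL : HoffsteinLuo1997_exists_twist_L_one_ne_zero)
    [NeZero (W.conductorNorm ℤ)]
    (hX : ClassX4M W p) (hr : W.analyticRank = 1)
    (D : ModularParametrizationData W (W.conductorNorm ℤ)) (hc : ¬ (p : ℤ) ∣ D.c)
    (htam : ¬ p ∣ W.tamagawaProduct) (hlowW : MissingLowerBoundAt W p)
    (hlow : ∀ (V : WeierstrassCurve ℚ) [V.IsElliptic] [V.IsGloballyMinimal], ClassX4M V p →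
      V.j = W.j → V.analyticRank = 0 → MissingLowerBoundAt V p) :
    BSDp W p :=
  bsdp_of_missingPPartAt W p hGZK (by rw [hr])
    (missingPPartAt_of_lower_of_upper W p hlowW
      (ClassX4M.missingUpperBoundAt_rankOne_of_lowerTwists_of_odd hGZ hKo hMN hGZK hmod hnf hHL hX hr
        D hc htam hlow))

/-! ### §3 (gen 13 addendum) X4(M), BOTH ranks, every odd `p`: the image binder is a RANK-ZERO binder only -/

/-- **X4(M), EITHER analytic rank, ANY odd `p`: `BSD(E,p)` from LOWER halves alone, with the image
hypothesis `Surj W p` required ONLY in analytic rank ZERO.** `(E,p) ∈ X4(M)` (`W` globally minimal),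
`ord_{s=1} L(E,s) ≤ 1`, datum `D` at level `N_E` with `p ∤ c(D)`, `p ∤ ∏_ℓ c_ℓ(E)` (both used in rank
one only), `hsurj : r_an(E) = 0 → ρ̄_{E,p} onto` (used in rank zero only: Kato's divisibility on the
`ω^{(p−1)/2}`-component via Wuthrich's Lemma 20 needs `ρ_{E♭,p^∞}` onto; Matar–Nekovář's form of
Kolyvagin's bound needs irreducibility only, which is part of `ClassX4`): if `E` itself and every
X4(M) pair `(V,p)` with `j(V) = j(E)` and `r_an(V) ≤ 1` satisfy `MissingLowerBoundAt · p`, then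
`BSDp W p`. Rank `0`: gen 9's `ClassX4M.bsdp_rankZero_of_surj_of_lower`; rank `1`:
`bsdp_of_classX4M_rankOne_of_lower_of_lowerTwists_of_odd` (this file). So on X4(M) the residual
image input of the cell is confined to rank ZERO (cell E-ii); E-iii needs none. X4(M) stays
CONSTRUCTION-SHAPED; nothing booked.
[cite: MatarNekovar2019, Thm. 0.3 (p. 456), §0.11 (p. 457)] [cite: Delbourgo1998, Prop. 4 (p. 144)]
[cite: Wuthrich2014, Lemma 20 (p. 399), Cor. 19 (p. 398)] [cite: Kato2004Asterisque, Thm. 17.4 (3) (p. 273)]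
[cite: HoffsteinLuo1997, Theorem (§1, pp. 435–436)] [cite: Miller2011LMS, Def. 1.1] -/
theorem bsdp_of_classX4M_of_surjRankZero_of_lowerHalves_of_odd
    (hDel : Delbourgo1998.prop4_rankZero_pow_dvd_constantCoeff)
    (hmodD : nonempty_modularParametrizationData)
    (hL20 : Wuthrich2014.lemma20_surjective_threeAdic_of_semistable)
    (hKato : Wuthrich2014.kato_halfEigenCharIdeal_dvd_cyclotomicPrime_of_surjective)
    (hGZ : ∀ (N : ℕ) [NeZero N] (W : WeierstrassCurve ℚ) (K : Type) [Field K] [NumberField K],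
      gross_zagier N W K)
    (hKo : ∀ (N : ℕ) [NeZero N] (W : WeierstrassCurve ℚ) (K : Type) [Field K] [NumberField K],
      kolyvagin N W K)
    (hMN : ∀ (N : ℕ) [NeZero N] (W : WeierstrassCurve ℚ) (K : Type) [Field K] [NumberField K],
      MatarNekovar2019.thm03_padicValNat_card_sha_le_of_irreducible N W K)
    (hnf : exists_isNewformOf) (hHL : HoffsteinLuo1997_exists_twist_L_one_ne_zero)
    (hGZK : rank_eq_analyticRank_of_analyticRank_le_one) (hmod : hasEntireLFunction_rat)
    [NeZero (W.conductorNorm ℤ)]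
    (hX : ClassX4M W p) (hr : W.analyticRank ≤ 1) (hsurj : W.analyticRank = 0 → Surj W p)
    (D : ModularParametrizationData W (W.conductorNorm ℤ)) (hc : ¬ (p : ℤ) ∣ D.c)
    (htam : ¬ p ∣ W.tamagawaProduct)
    (hlow : ∀ (V : WeierstrassCurve ℚ) [V.IsElliptic] [V.IsGloballyMinimal], ClassX4M V p →
      V.j = W.j → V.analyticRank ≤ 1 → MissingLowerBoundAt V p) :
    BSDp W p := by
  rcases Nat.le_one_iff_eq_zero_or_eq_one.mp hr with hr0 | hr1
  · exact ClassX4M.bsdp_rankZero_of_surj_of_lower hDel hGZK hmod hmodD hL20 hKato hX hr0 (hsurj hr0)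
      (hlow W hX rfl hr)
  · exact bsdp_of_classX4M_rankOne_of_lower_of_lowerTwists_of_odd hGZ hKo hMN hGZK hmod hnf hHL hX hr1
      D hc htam (hlow W hX rfl hr) fun V _ _ hV hj hr0 ↦
        hlow V hV hj (by rw [hr0]; exact zero_le_one)

end Summit.BirchSwinnertonDyer.Rank1Residual.AdditivePotMult

end
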